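import Mathlib
import HarnessLib

/-!
# Cell arithmetic for the chessboard transfer on dyadic tori
# (helper for support `ChessboardTransfer`, stmt-QuantumFields-23370, route `DyadicChessboard`)

Pure `ℕ/ℤ/ZMod` bookkeeping behind the Fröhlich–Israel–Lieb–Simon chessboard estimate on the torus `ℤ/(N·B)`
partitioned into `N` cells of side `B` per axis (K1's reflected-array site formula
`site = c·B + (p | B - 1 - p - χ)` by parity of the cell index `c`):

* `site_normalForm`, `site_margins` — every residue with distance `δ` from the cell faces is a reflected-array site
  with K1's margins;
* `even_val_reflect_iff`, `site_reflect_congr` — the block reflection `c ↦ 2k - 1 - c` flips the parity and carries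
  the site to its mirror image under the link reflection through the bond hyperplane `x = k·B - ½`;
* `val_sub_boundary_pos` — cells of the positive half `(c - k).val < N/2` sit in the positive half-torus of that
  link reflection;
* `cellIdx_ne_of_separated` — points at torus distance `≥ 2R + 4 ≥ B` lie in different cells;
* `exists_good_offset` — the offset pigeonhole (`n(2δ - 1) < B` ⇒ a common offset with all margins `≥ δ`);
* `exists_cells` — packaging: offset, distinct cells and parity-normalised positions for separated points.

References: J. Fröhlich, R. Israel, E. H. Lieb, B. Simon, CMP 62 (1978) Thm 4.1/4.3; S. Friedli, Y. Velenik,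
*Statistical Mechanics of Lattice Systems* (2017) §10.3.  Mathlib only.

HONEST FRAMING: helper toward the support item `ChessboardTransfer` (stmt-QuantumFields-23370) of route
`DyadicChessboard` (planner ym-idea-11 g9, LINE 1); the crux K1 `DyadicArrayCeiling` stays OPEN; no crux, no rung
(R2a is a RECORD rung) and no summit is proved, and the Yang–Mills mass gap is NOT proved by any of this.
Cell `ym-idea-1`, width seat `ym-line-sfw-p2-w5` g12 (free hands).  THEOREMS ONLY, definition-free.
-/

set_option autoImplicit false

namespace Summit.QuantumFields.YangMills.Theorems.DyadicChessboard.Cells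

/-! ## G1: in-cell normal form of a torus coordinate -/

/-- **In-cell normal form.**  For a residue `ym < N·B` with cell index `cv = ym / B` and in-cell residue
`res = ym % B` satisfying `res + χ + 1 ≤ B`, the parity-normalised position
`p = res` (even cell) / `p = B - 1 - res - χ` (odd cell) reproduces `ym` through the reflected-array site
formula `cv·B + (p | B - 1 - p - χ)`. [folklore] -/
theorem site_normalForm (B χ ym p : ℕ) (hres : ym % B + χ + 1 ≤ B)
    (hp : p = if Even (ym / B) then ym % B else B - 1 - ym % B - χ) :
    ((ym / B : ℕ) : ℤ) * (B : ℤ) + (if Even (ym / B) then (p : ℤ) else (B : ℤ) - 1 - (p : ℤ) - (χ : ℤ)) =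
      (ym : ℤ) := by
  have hdm : (B : ℤ) * (ym / B : ℕ) + (ym % B : ℕ) = ym := by exact_mod_cast Nat.div_add_mod ym B
  by_cases hev : Even (ym / B)
  · rw [if_pos hev] at hp ⊢
    rw [hp]; linarith
  · rw [if_neg hev] at hp ⊢
    have hp' : (p : ℤ) = (B : ℤ) - 1 - (ym % B : ℕ) - χ := by
      rw [hp]; push_cast [show ym % B + χ ≤ B - 1 by omega, show 1 ≤ B by omega]; omega
    rw [hp']; linarith

/-- **Margins of the normal form.**  If the residue keeps distance `δ ≥ 1` from both cell faces,
`δ - 1 ≤ res ≤ B - 1 - δ` (and `χ ≤ 1`), the parity-normalised position has K1's margins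
`δ ≤ p + 1`, `p + χ + δ ≤ B`. [folklore] -/
theorem site_margins (B χ ym p δ : ℕ) (hχ : χ ≤ 1) (hδ : 1 ≤ δ) (hlo : δ - 1 ≤ ym % B) (hhi : ym % B + 1 + δ ≤ B)
    (hp : p = if Even (ym / B) then ym % B else B - 1 - ym % B - χ) :
    δ ≤ p + 1 ∧ p + χ + δ ≤ B := by
  by_cases hev : Even (ym / B)
  · rw [if_pos hev] at hp; subst hp; omega
  · rw [if_neg hev] at hp; subst hp; omega

/-! ## G2: the reflected cell -/

/-- Parity flip: for `N` even, the reflected cell index `2k - 1 - c` has the opposite parity of `c`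
(as natural representatives). [folklore] -/
theorem even_val_reflect_iff {N : ℕ} [NeZero N] (hN : Even N) (c k : ZMod N) :
    Even (2 * k - 1 - c).val ↔ ¬ Even c.val := by
  -- `(2k-1-c).val ≡ 2 k.val - 1 - c.val (mod N)` and `N` is even
  have hcong : (((2 * k - 1 - c).val : ℤ) : ZMod N) = (((2 * (k.val : ℤ) - 1 - (c.val : ℤ)) : ℤ) : ZMod N) := by
    push_cast
    rw [ZMod.natCast_zmod_val, ZMod.natCast_zmod_val, ZMod.natCast_zmod_val]
  rw [ZMod.intCast_eq_intCast_iff] at hcong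
  obtain ⟨t, ht⟩ := (Int.modEq_iff_dvd.1 hcong.symm)
  -- ht : (2k-1-c).val - (2 kval - 1 - cval) = N * t  (up to sign conventions)
  obtain ⟨n2, hn2⟩ := hN
  have key : Even (((2 * k - 1 - c).val : ℤ) + (c.val : ℤ) + 1) := by
    refine ⟨(k.val : ℤ) + (n2 : ℤ) * t, ?_⟩
    have : (N : ℤ) = n2 + n2 := by exact_mod_cast hn2
    linear_combination ht + t * this
  constructor
  · intro h1 h2
    have h1' : Even (((2 * k - 1 - c).val : ℤ)) := (Int.even_coe_nat _).2 h1
    have h2' : Even ((c.val : ℤ)) := (Int.even_coe_nat _).2 h2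
    have : Even (1 : ℤ) := by
      have h12 := h1'.add h2'
      have := (Int.even_sub.2 (iff_of_true key h12))
      simp at this
    exact Int.not_even_one this
  · intro h2
    by_contra h1
    rw [Nat.not_even_iff_odd] at h1 h2
    have h1' : Odd (((2 * k - 1 - c).val : ℤ)) := (Int.odd_coe_nat _).2 h1
    have h2' : Odd ((c.val : ℤ)) := (Int.odd_coe_nat _).2 h2
    have h12 : Even (((2 * k - 1 - c).val : ℤ) + (c.val : ℤ)) := Odd.add_odd h1' h2'
    have : Even (1 : ℤ) := by
      have := (Int.even_sub.2 (iff_of_true key h12))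
      simp at this
    exact Int.not_even_one this

/-- **The reflected-array site of the reflected cell is the mirror image of the site** (modulo the torus
side `N·B`): with `c' = 2k - 1 - c` (the block reflection through the boundary `k`), the K1 site
`c'.val·B + (p | B-1-p-χ by parity of c')` is congruent to `2(k.val·B - 1) + 1 - site(c) - χ`, the image of
`site(c)` under the link reflection through the bond hyperplane `x = k.val·B - ½` (electric plaquettes hang one
unit lower). [folklore] -/
theorem site_reflect_congr {N : ℕ} [NeZero N] (hN : Even N) (B : ℕ) (c k : ZMod N) (p χ : ℤ) :
    (((((2 * k - 1 - c).val : ℕ) : ℤ) * (B : ℤ) +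
        (if Even (2 * k - 1 - c).val then p else (B : ℤ) - 1 - p - χ) : ℤ) : ZMod (N * B)) =
      (((2 * ((k.val : ℤ) * (B : ℤ) - 1) + 1 -
        (((c.val : ℕ) : ℤ) * (B : ℤ) + (if Even c.val then p else (B : ℤ) - 1 - p - χ)) - χ) : ℤ) : ZMod (N * B)) := by
  rw [ZMod.intCast_eq_intCast_iff]
  have hcong : (((2 * k - 1 - c).val : ℤ) : ZMod N) = (((2 * (k.val : ℤ) - 1 - (c.val : ℤ)) : ℤ) : ZMod N) := by
    push_cast
    rw [ZMod.natCast_zmod_val, ZMod.natCast_zmod_val, ZMod.natCast_zmod_val]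
  rw [ZMod.intCast_eq_intCast_iff] at hcong
  have hB : ((2 * k - 1 - c).val : ℤ) * (B : ℤ) ≡ (2 * (k.val : ℤ) - 1 - (c.val : ℤ)) * (B : ℤ) [ZMOD (N * B : ℕ)] := by
    push_cast
    exact hcong.mul_right'
  have hpar := even_val_reflect_iff hN c k
  by_cases hev : Even c.val
  · have hodd : ¬ Even (2 * k - 1 - c).val := fun h => (hpar.1 h) hev
    rw [if_neg hodd, if_pos hev]
    calc _ ≡ (2 * (k.val : ℤ) - 1 - (c.val : ℤ)) * (B : ℤ) + ((B : ℤ) - 1 - p - χ) [ZMOD (N * B : ℕ)] :=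
          hB.add_right _
      _ = _ := by ring
  · have heven : Even (2 * k - 1 - c).val := hpar.2 hev
    rw [if_pos heven, if_neg hev]
    calc _ ≡ (2 * (k.val : ℤ) - 1 - (c.val : ℤ)) * (B : ℤ) + p [ZMOD (N * B : ℕ)] := hB.add_right _
      _ = _ := by ring


/-! ## G3: localisation in the positive half -/

/-- **Half-slab localisation.**  If the cell `c` lies in the positive half of the block reflection through
the boundary `k` (`(c - k).val < N/2`, `N` even) then every site `c.val·B + u`, `u + 1 ≤ B`, of that cell
satisfies `1 ≤ (site - (k.val·B - 1)) mod (N·B) ≤ N·B/2`, i.e. it lies in the positive half-torus of the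
link reflection through the bond hyperplane `x = k.val·B - ½`. [folklore] -/
theorem val_sub_boundary_pos {N B : ℕ} [NeZero N] [NeZero (N * B)] (hN : Even N) (c k : ZMod N)
    (hc : (c - k).val < N / 2) (u : ℕ) (hu : u + 1 ≤ B) :
    1 ≤ (((c.val : ℤ) * (B : ℤ) + (u : ℤ) - ((k.val : ℤ) * (B : ℤ) - 1) : ℤ) : ZMod (N * B)).val ∧
      (((c.val : ℤ) * (B : ℤ) + (u : ℤ) - ((k.val : ℤ) * (B : ℤ) - 1) : ℤ) : ZMod (N * B)).val ≤ N * B / 2 := by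
  obtain ⟨n2, hn2⟩ := hN
  set t : ℕ := (c - k).val with ht_def
  have ht : ((c.val : ℤ) - (k.val : ℤ)) ≡ (t : ℤ) [ZMOD (N : ℕ)] := by
    rw [← ZMod.intCast_eq_intCast_iff]
    push_cast
    rw [ZMod.natCast_zmod_val, ZMod.natCast_zmod_val, ht_def, ZMod.natCast_zmod_val]
  have hmod : ((c.val : ℤ) * (B : ℤ) + (u : ℤ) - ((k.val : ℤ) * (B : ℤ) - 1)) ≡ ((t * B + u + 1 : ℕ) : ℤ)
      [ZMOD ((N * B : ℕ) : ℤ)] := by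
    have h1 : ((c.val : ℤ) - (k.val : ℤ)) * (B : ℤ) ≡ (t : ℤ) * (B : ℤ) [ZMOD ((N : ℕ) : ℤ) * (B : ℤ)] :=
      ht.mul_right'
    push_cast
    calc ((c.val : ℤ) * (B : ℤ) + (u : ℤ) - ((k.val : ℤ) * (B : ℤ) - 1))
        = ((c.val : ℤ) - (k.val : ℤ)) * (B : ℤ) + ((u : ℤ) + 1) := by ring
      _ ≡ (t : ℤ) * (B : ℤ) + ((u : ℤ) + 1) [ZMOD (N : ℤ) * (B : ℤ)] := h1.add_right _
      _ = (t : ℤ) * (B : ℤ) + (u : ℤ) + 1 := by ring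
  have hcast : (((c.val : ℤ) * (B : ℤ) + (u : ℤ) - ((k.val : ℤ) * (B : ℤ) - 1) : ℤ) : ZMod (N * B)) =
      ((t * B + u + 1 : ℕ) : ZMod (N * B)) := by
    have h := (ZMod.intCast_eq_intCast_iff _ _ _).2 hmod
    rwa [Int.cast_natCast] at h
  have hle : t * B + u + 1 ≤ N * B / 2 := by
    have h2 : t + 1 ≤ n2 := by omega
    have : N * B / 2 = n2 * B := by
      rw [hn2, show (n2 + n2) * B = n2 * B * 2 by ring, Nat.mul_div_cancel _ (by norm_num)]
    rw [this]
    calc t * B + u + 1 ≤ t * B + B := by omega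
      _ = (t + 1) * B := by ring
      _ ≤ n2 * B := Nat.mul_le_mul_right _ h2
  have hlt : t * B + u + 1 < N * B := by
    have hNB : 0 < N * B := Nat.pos_of_ne_zero (NeZero.ne _)
    have := Nat.div_lt_self hNB (by norm_num : 1 < 2)
    omega
  rw [hcast, ZMod.val_natCast_of_lt hlt]
  exact ⟨by omega, hle⟩

/-! ## G4: separated points lie in different cells -/

/-- **Separation forces distinct cells.**  Two integers whose difference has torus distance `≥ 2R + 4` on
`ℤ/(N·B)` (`B ≤ 2R + 4`, `2B ≤ N·B`) have different cell indices `⌊(· mod N·B)/B⌋` (in `ℤ/N`). [folklore] -/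
theorem cellIdx_ne_of_separated {N B : ℕ} [NeZero N] [NeZero (N * B)] (hB : 1 ≤ B) (hN2 : 2 ≤ N) {R : ℕ}
    (hBR : B ≤ 2 * R + 4) (a b : ℤ)
    (hsep : (2 * (R : ℤ) + 4) ≤ |((((a - b : ℤ) : ZMod (N * B))).valMinAbs : ℤ)|) :
    (((a : ZMod (N * B)).val / B : ℕ) : ZMod N) ≠ (((b : ZMod (N * B)).val / B : ℕ) : ZMod N) := by
  intro heq
  set ya : ℕ := (a : ZMod (N * B)).val with hya
  set yb : ℕ := (b : ZMod (N * B)).val with hyb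
  have hya_lt : ya < N * B := ZMod.val_lt _
  have hyb_lt : yb < N * B := ZMod.val_lt _
  have hBpos : 0 < B := hB
  have hca : ya / B < N := Nat.div_lt_of_lt_mul (by rwa [Nat.mul_comm] at hya_lt)
  have hcb : yb / B < N := Nat.div_lt_of_lt_mul (by rwa [Nat.mul_comm] at hyb_lt)
  -- equal cells as naturals
  have hcell : ya / B = yb / B := by
    have := (ZMod.natCast_eq_natCast_iff' (ya / B) (yb / B) N).1 heq
    rwa [Nat.mod_eq_of_lt hca, Nat.mod_eq_of_lt hcb] at this
  -- hence the residues differ by less than `B`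
  have hdiff : |(ya : ℤ) - (yb : ℤ)| < (B : ℤ) := by
    have h1 := Nat.div_add_mod ya B
    have h2 := Nat.div_add_mod yb B
    rw [← hcell] at h2
    have m1 := Nat.mod_lt ya hBpos
    have m2 := Nat.mod_lt yb hBpos
    have hnat : ya < yb + B ∧ yb < ya + B := by omega
    rw [abs_lt]; constructor <;> omega
  -- the torus difference `a - b` is represented by `ya - yb`
  have hrep : (((a - b : ℤ) : ZMod (N * B))) = (((ya : ℤ) - (yb : ℤ) : ℤ) : ZMod (N * B)) := by
    push_cast
    rw [hya, hyb, ZMod.natCast_zmod_val, ZMod.natCast_zmod_val]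
  set w : ℤ := ((((a - b : ℤ) : ZMod (N * B))).valMinAbs : ℤ) with hw
  have hwcong : (w : ZMod (N * B)) = (((ya : ℤ) - (yb : ℤ) : ℤ) : ZMod (N * B)) := by
    rw [hw, ZMod.coe_valMinAbs, hrep]
  have hdvd : ((N * B : ℕ) : ℤ) ∣ w - ((ya : ℤ) - (yb : ℤ)) :=
    (ZMod.intCast_eq_intCast_iff_dvd_sub _ _ _).1 hwcong.symm
  have hwabs : |w| ≤ ((N * B : ℕ) : ℤ) / 2 := by
    have := ZMod.natAbs_valMinAbs_le ((((a - b : ℤ) : ZMod (N * B))))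
    rw [hw, Int.abs_eq_natAbs]
    exact_mod_cast this
  have h2B : 2 * B ≤ N * B := Nat.mul_le_mul_right _ hN2
  have hsmall : |w - ((ya : ℤ) - (yb : ℤ))| < ((N * B : ℕ) : ℤ) := by
    have hNB : (((N * B : ℕ) : ℤ) / 2) * 2 ≤ ((N * B : ℕ) : ℤ) := Int.ediv_mul_le _ (by norm_num)
    calc |w - ((ya : ℤ) - (yb : ℤ))| ≤ |w| + |(ya : ℤ) - (yb : ℤ)| := abs_sub _ _
      _ < ((N * B : ℕ) : ℤ) / 2 + (B : ℤ) := add_lt_add_of_le_of_lt hwabs hdiff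
      _ ≤ ((N * B : ℕ) : ℤ) := by push_cast at hNB ⊢; omega
  have hzero : w - ((ya : ℤ) - (yb : ℤ)) = 0 := Int.eq_zero_of_abs_lt_dvd hdvd hsmall
  have hweq : w = (ya : ℤ) - (yb : ℤ) := by linarith
  have : (2 * (R : ℤ) + 4) < (B : ℤ) := by
    calc (2 * (R : ℤ) + 4) ≤ |w| := hsep
      _ = |(ya : ℤ) - (yb : ℤ)| := by rw [hweq]
      _ < (B : ℤ) := hdiff
  have : (2 * R + 4 : ℕ) < B := by exact_mod_cast this
  omega

/-! ## G5: the offset pigeonhole -/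

/-- **Offset pigeonhole.**  On `ℤ/B`, if `n·(2δ - 1) < B` then some common offset `t` moves all `n`
residues `a i` into the window `[δ - 1, B - 1 - δ]` (each residue forbids at most `2δ - 1` offsets). [folklore] -/
theorem exists_good_offset {B : ℕ} [NeZero B] {n : ℕ} (a : Fin n → ZMod B) (δ : ℕ) (hδ : 1 ≤ δ)
    (hcard : n * (2 * δ - 1) < B) :
    ∃ t : ZMod B, ∀ i, δ - 1 ≤ (a i + t).val ∧ (a i + t).val + 1 + δ ≤ B := by
  classical
  -- bad residues
  let bad : Finset (ZMod B) := Finset.univ.filter fun r => r.val < δ - 1 ∨ B < r.val + 1 + δ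
  have hbad_card : bad.card ≤ 2 * δ - 1 := by
    let T : Finset ℕ := Finset.range (δ - 1) ∪ Finset.Ico (B - δ) B
    have hT : T.card ≤ 2 * δ - 1 := by
      calc T.card ≤ (Finset.range (δ - 1)).card + (Finset.Ico (B - δ) B).card := Finset.card_union_le _ _
        _ = (δ - 1) + (B - (B - δ)) := by rw [Finset.card_range, Nat.card_Ico]
        _ ≤ 2 * δ - 1 := by omega
    refine le_trans ?_ hT
    refine Finset.card_le_card_of_injOn ZMod.val (fun r hr => ?_) ((ZMod.val_injective B).injOn)
    have hr' := (Finset.mem_filter.1 hr).2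
    have hrlt : r.val < B := ZMod.val_lt r
    simp only [T, Finset.coe_union, Finset.coe_range, Finset.coe_Ico, Set.mem_union, Set.mem_Iio, Set.mem_Ico]
    omega
  -- offsets that are bad for some point
  let BAD : Finset (ZMod B) := Finset.univ.biUnion fun i : Fin n => bad.image fun r => r - a i
  have hBAD : BAD.card < Fintype.card (ZMod B) := by
    rw [ZMod.card]
    calc BAD.card ≤ ∑ i : Fin n, (bad.image fun r => r - a i).card := Finset.card_biUnion_le
      _ ≤ ∑ _i : Fin n, (2 * δ - 1) := Finset.sum_le_sum fun i _ => Finset.card_image_le.trans hbad_card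
      _ = n * (2 * δ - 1) := by rw [Finset.sum_const, Finset.card_univ, Fintype.card_fin, smul_eq_mul]
      _ < B := hcard
  obtain ⟨t, -, ht⟩ : ∃ t ∈ (Finset.univ : Finset (ZMod B)), t ∉ BAD :=
    Finset.exists_mem_notMem_of_card_lt_card (by rwa [Finset.card_univ])
  refine ⟨t, fun i => ?_⟩
  have hnot : a i + t ∉ bad := by
    intro hmem
    apply ht
    refine Finset.mem_biUnion.2 ⟨i, Finset.mem_univ _, Finset.mem_image.2 ⟨a i + t, hmem, by ring⟩⟩
  have hlt : (a i + t).val < B := ZMod.val_lt _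
  simp only [bad, Finset.mem_filter, Finset.mem_univ, true_and, not_or, not_lt] at hnot
  omega


/-! ## G6: packaging — offset, cells and parity-normalised positions for separated points -/

/-- **Cells for separated points.**  On the torus `ℤ/L`, `L = N·B` (`N ≥ 2`), given `n` base points `x i ∈ ℤ⁴`
pairwise at torus distance `≥ 2R + 4 ≥ B` in some coordinate and a margin `δ ≥ 1` with `n(2δ - 1) < B`, there are a
common offset `t`, pairwise distinct cells `cell i ∈ (ℤ/N)⁴` and parity-normalised in-cell positions `p i` with K1's
margins (`δ ≤ p + 1`, `p + χ + δ ≤ B`) such that `x i + t` is congruent mod `L` to the reflected-array site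
`cell.val·B + (p | B - 1 - p - χ)`. [folklore] -/
theorem exists_cells {L N B : ℕ} [NeZero N] [NeZero B] [NeZero L] (hL : L = N * B) (hN2 : 2 ≤ N) {n : ℕ}
    (q : Fin n → Fin 4 × Fin 4) (x : Fin n → Fin 4 → ℤ) {R : ℕ} (hBR : B ≤ 2 * R + 4)
    (hsep : ∀ i j : Fin n, i ≠ j → ∃ k : Fin 4,
      (2 * (R : ℤ) + 4) ≤ |((((x i k - x j k : ℤ) : ZMod L)).valMinAbs : ℤ)|)
    (δ : ℕ) (hδ : 1 ≤ δ) (hcard : n * (2 * δ - 1) < B) :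
    ∃ (t : Fin 4 → ℤ) (cell : Fin n → Fin 4 → ZMod N) (p : Fin n → Fin 4 → ℕ),
      Function.Injective cell ∧
      (∀ i k, δ ≤ p i k + 1 ∧ p i k + (if k = (q i).1 ∨ k = (q i).2 then 1 else 0) + δ ≤ B) ∧
      ∀ i k, (((x i + t) k : ℤ) : ZMod L) =
        (((((cell i k).val : ℕ) : ℤ) * (B : ℤ) + (if Even (cell i k).val then (p i k : ℤ)
          else (B : ℤ) - 1 - (p i k : ℤ) - (if k = (q i).1 ∨ k = (q i).2 then 1 else 0)) : ℤ) : ZMod L) := by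
  classical
  subst hL
  have hB : 1 ≤ B := Nat.one_le_iff_ne_zero.2 (NeZero.ne B)
  -- the offset, coordinate by coordinate
  choose tk htk using fun k : Fin 4 =>
    exists_good_offset (B := B) (fun i : Fin n => ((x i k : ℤ) : ZMod B)) δ hδ hcard
  let t : Fin 4 → ℤ := fun k => ((tk k).val : ℤ)
  -- torus representatives, cells, residues
  let ym : Fin n → Fin 4 → ℕ := fun i k => (((x i + t) k : ℤ) : ZMod (N * B)).val
  let cell : Fin n → Fin 4 → ZMod N := fun i k => ((ym i k / B : ℕ) : ZMod N)
  let p : Fin n → Fin 4 → ℕ := fun i k =>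
    if Even (ym i k / B) then ym i k % B else B - 1 - ym i k % B - (if k = (q i).1 ∨ k = (q i).2 then 1 else 0)
  have hym_lt : ∀ i k, ym i k < N * B := fun i k => ZMod.val_lt _
  have hcv_lt : ∀ i k, ym i k / B < N := fun i k =>
    Nat.div_lt_of_lt_mul (by rw [Nat.mul_comm]; exact hym_lt i k)
  have hcell_val : ∀ i k, (cell i k).val = ym i k / B := fun i k => ZMod.val_natCast_of_lt (hcv_lt i k)
  -- the residue of `x i k + t k` mod `B` is the good residue chosen by the pigeonhole
  have hres : ∀ i k, ym i k % B = (((x i k : ℤ) : ZMod B) + tk k).val := by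
    intro i k
    have h1 : (((ym i k : ℕ) : ℤ) : ZMod (N * B)) = (((x i + t) k : ℤ) : ZMod (N * B)) := by
      simp [ym]
    have h2 : ((ym i k : ℕ) : ℤ) ≡ (x i + t) k [ZMOD ((N * B : ℕ) : ℤ)] := (ZMod.intCast_eq_intCast_iff _ _ _).1 h1
    have h3 : ((ym i k : ℕ) : ℤ) ≡ (x i + t) k [ZMOD (B : ℤ)] := by
      push_cast at h2; exact Int.ModEq.of_mul_left _ h2
    have h4 : (((ym i k : ℕ) : ℤ) : ZMod B) = (((x i + t) k : ℤ) : ZMod B) := (ZMod.intCast_eq_intCast_iff _ _ _).2 h3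
    have h5 : (((x i + t) k : ℤ) : ZMod B) = ((x i k : ℤ) : ZMod B) + tk k := by
      simp [t]
    rw [Int.cast_natCast] at h4
    rw [← ZMod.val_natCast, h4, h5]
  refine ⟨t, cell, p, ?_, ?_, ?_⟩
  · -- injectivity from separation
    intro i j hij
    by_contra hne
    obtain ⟨k, hk⟩ := hsep i j hne
    have hk' : (2 * (R : ℤ) + 4) ≤ |(((((x i + t) k - (x j + t) k : ℤ)) : ZMod (N * B)).valMinAbs : ℤ)| := by
      have : (x i + t) k - (x j + t) k = x i k - x j k := by simp only [Pi.add_apply]; ring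
      rw [this]; exact hk
    have hcells := cellIdx_ne_of_separated (N := N) (B := B) hB hN2 hBR ((x i + t) k) ((x j + t) k) hk'
    exact hcells (by simpa [cell, ym] using congrFun hij k)
  · -- margins
    intro i k
    have hw := htk k i
    have hχ : (if k = (q i).1 ∨ k = (q i).2 then 1 else 0) ≤ 1 := by split_ifs <;> omega
    refine site_margins B _ (ym i k) (p i k) δ hχ hδ ?_ ?_ rfl
    · rw [hres]; exact hw.1
    · rw [hres]; exact hw.2
  · -- the site formula
    intro i k
    have hw := htk k i
    have hresB : ym i k % B + (if k = (q i).1 ∨ k = (q i).2 then 1 else 0) + 1 ≤ B := by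
      rw [hres]; split_ifs <;> omega
    have key := site_normalForm B (if k = (q i).1 ∨ k = (q i).2 then 1 else 0) (ym i k) (p i k) hresB rfl
    rw [hcell_val]
    have hcast : ((if k = (q i).1 ∨ k = (q i).2 then 1 else 0 : ℕ) : ℤ) = (if k = (q i).1 ∨ k = (q i).2 then 1 else 0 : ℤ) := by
      push_cast; rfl
    rw [hcast] at key
    rw [key]
    simp [ym]

end Summit.QuantumFields.YangMills.Theorems.DyadicChessboard.Cells
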